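import Summits.SmoothPoincare4.SmoothPoincare4.Theorems.ConvexBisectionAcyclicBisectionExistsChartedChainScale
import Summits.SmoothPoincare4.SmoothPoincare4.Theorems.ConvexBisectionAcyclicBisectionExistsChartedChainSymmetry
import Summits.SmoothPoincare4.SmoothPoincare4.Theorems.ConvexBisectionAcyclicBisectionExistsPageRotationCalculus
import HarnessLib

/-!
# The product chart of the page family along an annulus of the page of direction `1`
(wave 6, brick G6-5 — first piece of (R-TWIST), the page Dehn twist DIFFEOMORPHISM along a charted
page curve, for node N3a `node_STcurve` of stub `stub_STgeo` = NF4 N3, line `modp-braid-orbits`, crux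
`ConvexBisection.AcyclicBisectionExists`, item stmt-SmoothPoincare4-10508; registered sub-goal
`helper_prodChart_localInverse`)

A page Dehn twist of `Base g` must be "Dehn twist × identity" on ALL the curves
`C_{w'} = {y² = x^{2g+1} + 1 + w'}`, `|w'| ≤ 1/2 + ε` (report G6 §3 (i): it cannot be cut off in the
transverse page coordinate `w`).  The curves are complex rescalings of each other
(`pagePt`, `scaleX`, `scaleY` of `…ChartedChainScale.lean`), so an ambient annulus map
`Φ : ℝ × ℝ → ℝ⁴` with values in the page of direction `1` (`w ∘ Φ = 1/2`) spreads to the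
**product chart**

  `prodChart g Φ (w', p) = sclL (scaleX g (2w') / scaleX g 1) (scaleY (2w') / scaleY 1) (Φ p)`

(`sclL a b` the real-linear scaling `(x, y) ↦ (a x, b y)` of `ℂ² = ℝ⁴`).  This file proves: `w ∘ prodChart = w'`
(`w_prodChart`), `prodChart (1/2, p) = Φ p`, periodicity, smoothness on `{‖2w'‖ < 2}` (the scalings
are holomorphic in `w'` on the slit plane: `contDiffAt_scaleX`, `contDiffAt_scaleY`), injectivity
from that of `Φ` (`prodChart_inj`), and — the key — **injectivity of the differential**
(`injective_fderiv_prodChart`: apply `dw` to kill the `w'`-component, then the injective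
differential of `Φ` composed with the invertible scaling), whence a strict derivative which is a
linear isomorphism `ℂ × ℝ² ≃ ℝ⁴` and the inverse function theorem: `prodChart` is open with smooth
local inverses (`helper_prodChart_localInverse`).  The sequel builds the twist `Γ ∘ shear ∘ Γ⁻¹`
on the open image and restricts it to a diffeomorphism of `Base g`.

Two definitions (`sclL`, `prodChart`); everything else proved; no named facts, no `sorry`.
Reference: J. M. Lee, *Introduction to Smooth Manifolds* (2013), Thm. 4.5 (inverse function
theorem) [LeeSmoothManifolds2013]. [folklore]
-/

noncomputable section

set_option linter.dupNamespace false

open scoped Manifold ContDiff Topology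
open Set Function Metric Complex
open Literature.Topology.FourManifolds Literature.Topology.FourManifolds.LefschetzBase

namespace Summit.SmoothPoincare4.SmoothPoincare4.Theorems.AcyclicBisectionExists.ModpBraidOrbits

variable {g : ℕ}

/-! ## §1 The real-linear scaling `(x, y) ↦ (a x, b y)` of `ℂ² = ℝ⁴` -/

/-- **The scaling** `(x, y) ↦ (a x, b y)` as a real continuous linear map of `ℝ⁴`. [folklore] -/
def sclL (a b : ℂ) : EuclideanSpace ℝ (Fin 4) →L[ℝ] EuclideanSpace ℝ (Fin 4) :=
  LinearMap.toContinuousLinearMap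
    { toFun := fun p => mk (a * cx p) (b * cy p)
      map_add' := fun p q => by rw [mk_add_mk, cx_add, cy_add, mul_add, mul_add]
      map_smul' := fun t p => by
        rw [RingHom.id_apply, smul_mk, cx_smul, cy_smul]; ring_nf }

/-- The formula of the scaling. [folklore] -/
theorem sclL_apply (a b : ℂ) (p : EuclideanSpace ℝ (Fin 4)) : sclL a b p = mk (a * cx p) (b * cy p) := rfl

/-- `x`-coordinate of the scaling. [folklore] -/
@[simp] theorem cx_sclL (a b : ℂ) (p : EuclideanSpace ℝ (Fin 4)) : cx (sclL a b p) = a * cx p := by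
  rw [sclL_apply, cx_mk]

/-- `y`-coordinate of the scaling. [folklore] -/
@[simp] theorem cy_sclL (a b : ℂ) (p : EuclideanSpace ℝ (Fin 4)) : cy (sclL a b p) = b * cy p := by
  rw [sclL_apply, cy_mk]

/-- The scaling by non-zero factors is injective. [folklore] -/
theorem sclL_injective {a b : ℂ} (ha : a ≠ 0) (hb : b ≠ 0) : Injective (sclL a b) := by
  intro p q h
  have hx := congrArg cx h
  have hy := congrArg cy h
  rw [cx_sclL, cx_sclL] at hx
  rw [cy_sclL, cy_sclL] at hy
  rw [← mk_cx_cy p, ← mk_cx_cy q, mul_left_cancel₀ ha hx, mul_left_cancel₀ hb hy]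

/-- The unit scaling is the identity. [folklore] -/
theorem sclL_one_one (p : EuclideanSpace ℝ (Fin 4)) : sclL 1 1 p = p := by
  rw [sclL_apply, one_mul, one_mul, mk_cx_cy]

/-! ## §2 The page scalings for `‖c‖ < 2`: non-vanishing and smoothness -/

/-- `1 + c/2` lies in the slit plane for `‖c‖ < 2`. [folklore] -/
theorem one_add_half_mem_slitPlane {c : ℂ} (hc : ‖c‖ < 2) : 1 + c / 2 ∈ slitPlane := by
  rw [Complex.mem_slitPlane_iff]; left
  have h : |(c / 2).re| ≤ ‖c / 2‖ := Complex.abs_re_le_norm _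
  rw [norm_div, Complex.norm_two] at h
  have h2 : -(‖c‖ / 2) ≤ (c / 2).re := (abs_le.1 h).1
  rw [Complex.add_re, Complex.one_re]
  linarith

/-- `1 + c/2 ≠ 0` for `‖c‖ < 2`. [folklore] -/
theorem one_add_half_ne_zero' {c : ℂ} (hc : ‖c‖ < 2) : 1 + c / 2 ≠ 0 :=
  Complex.slitPlane_ne_zero (one_add_half_mem_slitPlane hc)

/-- `λ ≠ 0` for `‖c‖ < 2`. [folklore] -/
theorem scaleX_ne_zero' {c : ℂ} (hc : ‖c‖ < 2) : scaleX g c ≠ 0 := by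
  rw [scaleX, Ne, Complex.cpow_eq_zero_iff, not_and_or]
  exact Or.inl (one_add_half_ne_zero' hc)

/-- `μ ≠ 0` for `‖c‖ < 2`. [folklore] -/
theorem scaleY_ne_zero' {c : ℂ} (hc : ‖c‖ < 2) : scaleY c ≠ 0 :=
  csqrt_ne_zero (one_add_half_ne_zero' hc)

/-- A constant complex power is real-smooth on the slit plane. [folklore] -/
theorem contDiffAt_cpow_const_of_mem_slitPlane {z : ℂ} (hz : z ∈ slitPlane) (e : ℂ) :
    ContDiffAt ℝ ∞ (fun z : ℂ => z ^ e) z := by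
  have hd : DifferentiableOn ℂ (fun z : ℂ => z ^ e) slitPlane := fun x hx =>
    (Complex.hasStrictDerivAt_cpow_const (Complex.mem_slitPlane_iff.1 hx)).hasDerivAt.differentiableAt.differentiableWithinAt
  have h := (hd.contDiffOn (n := ∞) Complex.isOpen_slitPlane).contDiffAt (Complex.isOpen_slitPlane.mem_nhds hz)
  exact h.restrict_scalars ℝ

/-- **`c ↦ scaleX g c` is smooth on `‖c‖ < 2`.** [folklore] -/
theorem contDiffAt_scaleX {c : ℂ} (hc : ‖c‖ < 2) : ContDiffAt ℝ ∞ (scaleX g) c := by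
  have h1 : ContDiffAt ℝ ∞ (fun c : ℂ => 1 + c / 2) c := (contDiff_const.add (contDiff_id.div_const _)).contDiffAt
  exact (contDiffAt_cpow_const_of_mem_slitPlane (one_add_half_mem_slitPlane hc) _).comp c h1

/-- **`c ↦ scaleY c` is smooth on `‖c‖ < 2`.** [folklore] -/
theorem contDiffAt_scaleY {c : ℂ} (hc : ‖c‖ < 2) : ContDiffAt ℝ ∞ scaleY c := by
  have h1 : ContDiffAt ℝ ∞ (fun c : ℂ => 1 + c / 2) c := (contDiff_const.add (contDiff_id.div_const _)).contDiffAt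
  exact (contDiffAt_cpow_const_of_mem_slitPlane (one_add_half_mem_slitPlane hc) _).comp c h1

/-! ## §3 The product chart -/

/-- **The product chart of the page family along an ambient annulus `Φ` of the page of direction
`1`**: `(w', p) ↦` the rescaling of `Φ p ∈ C_{1/2}` to the curve `C_{w'}`. [folklore] -/
def prodChart (g : ℕ) (Φ : ℝ × ℝ → EuclideanSpace ℝ (Fin 4)) (q : ℂ × (ℝ × ℝ)) : EuclideanSpace ℝ (Fin 4) :=
  sclL (scaleX g (2 * q.1) / scaleX g 1) (scaleY (2 * q.1) / scaleY 1) (Φ q.2)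

variable {Φ : ℝ × ℝ → EuclideanSpace ℝ (Fin 4)}

/-- The product chart, unfolded. [folklore] -/
theorem prodChart_apply (q : ℂ × (ℝ × ℝ)) : prodChart g Φ q =
    sclL (scaleX g (2 * q.1) / scaleX g 1) (scaleY (2 * q.1) / scaleY 1) (Φ q.2) := rfl

/-- `‖1‖ < 2` bookkeeping. [folklore] -/
theorem norm_one_lt_two' : ‖(1 : ℂ)‖ < 2 := by rw [norm_one]; norm_num

/-- **The product chart is fibred over `w`**: `w (prodChart (w', p)) = w'` when `w (Φ p) = 1/2`.
[folklore] -/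
theorem w_prodChart (hΦ : ∀ p, w g (Φ p) = 1 / 2) (q : ℂ × (ℝ × ℝ)) : w g (prodChart g Φ q) = q.1 := by
  have h1 : cy (Φ q.2) ^ 2 - cx (Φ q.2) ^ (2 * g + 1) = 3 / 2 := by
    have h := hΦ q.2; rw [w_eq'] at h; linear_combination h
  have hX : scaleX g 1 ^ (2 * g + 1) = 3 / 2 := by rw [scaleX_pow]; norm_num
  have hY : scaleY 1 ^ 2 = 3 / 2 := by rw [scaleY_sq]; norm_num
  have hX0 : scaleX g 1 ^ (2 * g + 1) ≠ 0 := by rw [hX]; norm_num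
  have hY0 : scaleY 1 ^ 2 ≠ 0 := by rw [hY]; norm_num
  rw [w_eq', prodChart_apply, cx_sclL, cy_sclL, mul_pow, mul_pow, div_pow, div_pow, scaleX_pow, scaleY_sq,
    hX, hY]
  field_simp
  linear_combination (2 + 2 * q.1) * h1

/-- **On the page itself the product chart is `Φ`**: `prodChart (1/2, p) = Φ p`. [folklore] -/
theorem prodChart_half (p : ℝ × ℝ) : prodChart g Φ (1 / 2, p) = Φ p := by
  rw [prodChart_apply]
  dsimp only
  rw [show (2 : ℂ) * (1 / 2) = 1 by norm_num, div_self (scaleX_ne_zero' norm_one_lt_two'),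
    div_self (scaleY_ne_zero' norm_one_lt_two'), sclL_one_one]

/-- Periodicity in `u` is inherited from `Φ`. [folklore] -/
theorem prodChart_periodic (hΦ1 : ∀ u r, Φ (u + 1, r) = Φ (u, r)) (w' : ℂ) (u r : ℝ) :
    prodChart g Φ (w', (u + 1, r)) = prodChart g Φ (w', (u, r)) := by
  rw [prodChart_apply, prodChart_apply]
  dsimp only
  rw [hΦ1]

/-- **Injectivity from that of `Φ`**: equal values force equal `w'` and equal `Φ p`. [folklore] -/
theorem prodChart_inj (hΦ : ∀ p, w g (Φ p) = 1 / 2) {q q' : ℂ × (ℝ × ℝ)} (hq : ‖2 * q.1‖ < 2)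
    (h : prodChart g Φ q = prodChart g Φ q') : q.1 = q'.1 ∧ Φ q.2 = Φ q'.2 := by
  have h1 : q.1 = q'.1 := by rw [← w_prodChart hΦ q, ← w_prodChart hΦ q', h]
  refine ⟨h1, ?_⟩
  rw [prodChart_apply, prodChart_apply, ← h1] at h
  exact sclL_injective (div_ne_zero (scaleX_ne_zero' hq) (scaleX_ne_zero' norm_one_lt_two'))
    (div_ne_zero (scaleY_ne_zero' hq) (scaleY_ne_zero' norm_one_lt_two')) h

/-- **Smoothness** at points with `‖2w'‖ < 2`, for smooth `Φ`. [folklore] -/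
theorem contDiffAt_prodChart (hΦs : ContDiff ℝ ∞ Φ) {q : ℂ × (ℝ × ℝ)} (hq : ‖2 * q.1‖ < 2) :
    ContDiffAt ℝ ∞ (prodChart g Φ) q := by
  have h2 : ContDiffAt ℝ ∞ (fun q : ℂ × (ℝ × ℝ) => 2 * q.1) q := (contDiff_const.mul contDiff_fst).contDiffAt
  have hX : ContDiffAt ℝ ∞ (fun q : ℂ × (ℝ × ℝ) => scaleX g (2 * q.1) / scaleX g 1) q :=
    ((contDiffAt_scaleX hq).comp q h2).div_const _
  have hY : ContDiffAt ℝ ∞ (fun q : ℂ × (ℝ × ℝ) => scaleY (2 * q.1) / scaleY 1) q :=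
    ((contDiffAt_scaleY hq).comp q h2).div_const _
  have hΦq : ContDiffAt ℝ ∞ (fun q : ℂ × (ℝ × ℝ) => Φ q.2) q := (hΦs.comp contDiff_snd).contDiffAt
  have hcx : ContDiffAt ℝ ∞ (fun q : ℂ × (ℝ × ℝ) => cx (Φ q.2)) q := contDiff_cx.contDiffAt.comp q hΦq
  have hcy : ContDiffAt ℝ ∞ (fun q : ℂ × (ℝ × ℝ) => cy (Φ q.2)) q := contDiff_cy.contDiffAt.comp q hΦq
  have hfun : prodChart g Φ = fun q : ℂ × (ℝ × ℝ) =>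
      mk (scaleX g (2 * q.1) / scaleX g 1 * cx (Φ q.2)) (scaleY (2 * q.1) / scaleY 1 * cy (Φ q.2)) := by
    funext q'
    rw [prodChart_apply, sclL_apply]
  rw [hfun]
  exact ContDiffAt.mk₂ (hX.mul hcx) (hY.mul hcy)

/-- The set `{‖2w'‖ < 2}` is open. [folklore] -/
theorem isOpen_normTwoMul_lt : IsOpen {q : ℂ × (ℝ × ℝ) | ‖2 * q.1‖ < 2} := by
  have h : Continuous fun q : ℂ × (ℝ × ℝ) => ‖(2 : ℂ) * q.1‖ :=
    continuous_norm.comp ((continuous_const (y := (2 : ℂ))).mul continuous_fst)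
  exact isOpen_lt h continuous_const

/-! ## §4 The differential of the product chart is injective -/

/-- The partial map `p ↦ prodChart (w', p)` is the scaling of `Φ`; its differential. [folklore] -/
theorem hasFDerivAt_prodChart_snd (hΦs : ContDiff ℝ ∞ Φ) (w' : ℂ) (p : ℝ × ℝ) :
    HasFDerivAt (fun p' : ℝ × ℝ => prodChart g Φ (w', p'))
      ((sclL (scaleX g (2 * w') / scaleX g 1) (scaleY (2 * w') / scaleY 1)).comp (fderiv ℝ Φ p)) p := by
  have hfun : (fun p' : ℝ × ℝ => prodChart g Φ (w', p')) =
      ⇑(sclL (scaleX g (2 * w') / scaleX g 1) (scaleY (2 * w') / scaleY 1)) ∘ Φ := by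
    funext p'
    rw [comp_apply, prodChart_apply]
  rw [hfun]
  exact (sclL (scaleX g (2 * w') / scaleX g 1) (scaleY (2 * w') / scaleY 1)).hasFDerivAt.comp p
    (hΦs.differentiable (by simp) p).hasFDerivAt

/-- **The differential of the product chart is injective** wherever the differential of `Φ` is.
[folklore] -/
theorem injective_fderiv_prodChart (hΦs : ContDiff ℝ ∞ Φ) (hΦ : ∀ p, w g (Φ p) = 1 / 2)
    {q : ℂ × (ℝ × ℝ)} (hq : ‖2 * q.1‖ < 2) (hinj : Injective (fderiv ℝ Φ q.2)) :
    Injective (fderiv ℝ (prodChart g Φ) q) := by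
  have hG : ContDiffAt ℝ ∞ (prodChart g Φ) q := contDiffAt_prodChart hΦs hq
  have hGd : DifferentiableAt ℝ (prodChart g Φ) q := hG.differentiableAt (by simp)
  -- `w ∘ prodChart = fst`
  have hwG : (fun q' : ℂ × (ℝ × ℝ) => w g (prodChart g Φ q')) = Prod.fst := funext (w_prodChart hΦ)
  have h1 : (fderiv ℝ (w g) (prodChart g Φ q)).comp (fderiv ℝ (prodChart g Φ) q) =
      ContinuousLinearMap.fst ℝ ℂ (ℝ × ℝ) := by
    rw [← fderiv_fst (p := q), ← hwG]
    exact (fderiv_comp q ((contDiff_w g).differentiable (by simp) _) hGd).symm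
  -- the partial differential in `p`
  have h2 : (fderiv ℝ (prodChart g Φ) q).comp (ContinuousLinearMap.inr ℝ ℂ (ℝ × ℝ)) =
      (sclL (scaleX g (2 * q.1) / scaleX g 1) (scaleY (2 * q.1) / scaleY 1)).comp (fderiv ℝ Φ q.2) := by
    have hι : HasFDerivAt (fun p' : ℝ × ℝ => ((q.1, p') : ℂ × (ℝ × ℝ))) (ContinuousLinearMap.inr ℝ ℂ (ℝ × ℝ)) q.2 :=
      hasFDerivAt_prodMk_right q.1 q.2
    have hc := hGd.hasFDerivAt.comp q.2 hι
    exact hc.unique (hasFDerivAt_prodChart_snd hΦs q.1 q.2)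
  intro v₁ v₂ hv₁₂
  rw [← sub_eq_zero]
  set v := v₁ - v₂ with hvdef
  have hv : fderiv ℝ (prodChart g Φ) q v = 0 := by rw [hvdef, map_sub, hv₁₂, sub_self]
  have hv1 : v.1 = 0 := by
    have h := congrArg (fun L : (ℂ × (ℝ × ℝ)) →L[ℝ] ℂ => L v) h1
    simp only [ContinuousLinearMap.coe_comp, comp_apply, ContinuousLinearMap.coe_fst'] at h
    rw [← h, hv, map_zero]
  have hv2 : v.2 = 0 := by
    have h := congrArg (fun L : (ℝ × ℝ) →L[ℝ] EuclideanSpace ℝ (Fin 4) => L v.2) h2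
    simp only [ContinuousLinearMap.coe_comp, comp_apply, ContinuousLinearMap.inr_apply] at h
    have hv' : ((0 : ℂ), v.2) = v := by rw [← hv1]
    rw [hv', hv] at h
    have h3 : fderiv ℝ Φ q.2 v.2 = 0 := by
      apply sclL_injective (div_ne_zero (scaleX_ne_zero' hq) (scaleX_ne_zero' norm_one_lt_two'))
        (div_ne_zero (scaleY_ne_zero' hq) (scaleY_ne_zero' norm_one_lt_two'))
      rw [← h, map_zero]
    exact hinj (by rw [h3, map_zero])
  exact Prod.ext hv1 hv2

/-! ## §5 The inverse function theorem for the product chart -/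

/-- `dim_ℝ (ℂ × ℝ²) = 4 = dim_ℝ ℝ⁴`. [folklore] -/
theorem finrank_prod_eq_four :
    Module.finrank ℝ (ℂ × (ℝ × ℝ)) = Module.finrank ℝ (EuclideanSpace ℝ (Fin 4)) := by
  rw [Module.finrank_prod, Module.finrank_prod, Complex.finrank_real_complex, Module.finrank_self,
    finrank_euclideanSpace_fin]

/-- **The differential as a linear isomorphism `ℂ × ℝ² ≃ ℝ⁴`** (injective between spaces of the same
finite dimension), and the strict derivative. [folklore] -/
theorem exists_hasStrictFDerivAt_prodChart (hΦs : ContDiff ℝ ∞ Φ) (hΦ : ∀ p, w g (Φ p) = 1 / 2)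
    {q : ℂ × (ℝ × ℝ)} (hq : ‖2 * q.1‖ < 2) (hinj : Injective (fderiv ℝ Φ q.2)) :
    ∃ e : (ℂ × (ℝ × ℝ)) ≃L[ℝ] EuclideanSpace ℝ (Fin 4),
      (e : (ℂ × (ℝ × ℝ)) →L[ℝ] EuclideanSpace ℝ (Fin 4)) = fderiv ℝ (prodChart g Φ) q ∧
      HasStrictFDerivAt (prodChart g Φ) (e : (ℂ × (ℝ × ℝ)) →L[ℝ] EuclideanSpace ℝ (Fin 4)) q := by
  have hi := injective_fderiv_prodChart hΦs hΦ hq hinj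
  set L : (ℂ × (ℝ × ℝ)) →ₗ[ℝ] EuclideanSpace ℝ (Fin 4) := (fderiv ℝ (prodChart g Φ) q).toLinearMap with hL
  set e₀ : (ℂ × (ℝ × ℝ)) ≃ₗ[ℝ] EuclideanSpace ℝ (Fin 4) :=
    LinearMap.linearEquivOfInjective L hi finrank_prod_eq_four with he₀
  have hE : (e₀.toContinuousLinearEquiv : (ℂ × (ℝ × ℝ)) →L[ℝ] EuclideanSpace ℝ (Fin 4)) =
      fderiv ℝ (prodChart g Φ) q := ContinuousLinearMap.ext fun v => rfl
  refine ⟨e₀.toContinuousLinearEquiv, hE, ?_⟩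
  rw [hE]
  exact (contDiffAt_prodChart hΦs hq (g := g) (Φ := Φ)).hasStrictFDerivAt (by simp)

/-- **Sub-goal `helper_prodChart_localInverse`** (G6-5, first piece of (R-TWIST) for node N3a): at
every point `q = (w', p)` with `‖2w'‖ < 2` where the differential of the smooth ambient annulus map
`Φ` (with `w ∘ Φ = 1/2`) is injective, the product chart maps neighbourhoods of `q` onto
neighbourhoods of its value and has a smooth local inverse. [cite: LeeSmoothManifolds2013, Thm. 4.5] -/
theorem helper_prodChart_localInverse : ∀ (g : ℕ) (Φ : ℝ × ℝ → EuclideanSpace ℝ (Fin 4)), ContDiff ℝ ∞ Φ → (∀ p, Literature.Topology.FourManifolds.LefschetzBase.w g (Φ p) = 1 / 2) → ∀ (q : ℂ × (ℝ × ℝ)), ‖2 * q.1‖ < 2 → Function.Injective (fderiv ℝ Φ q.2) → Filter.map (Summit.SmoothPoincare4.SmoothPoincare4.Theorems.AcyclicBisectionExists.ModpBraidOrbits.prodChart g Φ) (𝓝 q) = 𝓝 (Summit.SmoothPoincare4.SmoothPoincare4.Theorems.AcyclicBisectionExists.ModpBraidOrbits.prodChart g Φ q) ∧ ∃ L : EuclideanSpace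 ℝ (Fin 4) → ℂ × (ℝ × ℝ), ContDiffAt ℝ ∞ L (Summit.SmoothPoincare4.SmoothPoincare4.Theorems.AcyclicBisectionExists.ModpBraidOrbits.prodChart g Φ q) ∧ L (Summit.SmoothPoincare4.SmoothPoincare4.Theorems.AcyclicBisectionExists.ModpBraidOrbits.prodChart g Φ q) = q ∧ (∀ᶠ q' in 𝓝 q, L (Summit.SmoothPoincare4.SmoothPoincare4.Theorems.AcyclicBisectionExists.ModpBraidOrbits.prodChart g Φ q') = q') ∧ (∀ᶠ y in 𝓝 (Summit.SmoothPoincare4.SmoothPoincare4.Theorems.AcyclicBisectionExists.ModpBraidOrbits.prodChart g Φ q), Summit.SmoothPoincare4.SmoothPoincare4.Theorems.AcyclicBisectionExists.ModpBraidOrbits.prodChart g Φ (L y) = y) := by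
  intro g Φ hΦs hΦ q hq hinj
  obtain ⟨e, -, he⟩ := exists_hasStrictFDerivAt_prodChart hΦs hΦ hq hinj
  have hc : ContDiffAt ℝ ∞ (prodChart g Φ) q := contDiffAt_prodChart hΦs hq
  refine ⟨he.map_nhds_eq_of_equiv, hc.localInverse he.hasFDerivAt (by simp), hc.to_localInverse he.hasFDerivAt (by simp),
    hc.localInverse_apply_image he.hasFDerivAt (by simp), ?_, ?_⟩
  · exact he.eventually_left_inverse
  · exact he.eventually_right_inverse

end Summit.SmoothPoincare4.SmoothPoincare4.Theorems.AcyclicBisectionExists.ModpBraidOrbits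

end
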